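import Mathlib
import Summits.NavierStokesRegularity.FluidComputer.AbcClassIEigenpairOfComplexBases

/-!
# GROUP-B, **CLASS I** — THE CONJUGATE PARTNER: an `amc`-coordinate eigenvector for `λ⋆` gives the classical eigenvalue
# `2π·conj λ⋆` as well (the HOPF PAIR) (profile-cert-3 g9, cell `ns-blowup`, 2026-08-27)
HONEST FRAMING (D-0035/D-0074): not a claim about Navier–Stokes blow-up. WHAT THIS IS NOT: not NS evidence;
MODEL lane (NS linearised about `abcFlow 1 1 1`, CLASS I — the Hopf rows T2/T4); no certificate, number or census
word moves. **`isLinNSEigenvalue_conj_of_amc_coords`**: for ANY family `wf` of complex orthonormal CLASS-I orbit bases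
with complex first-order matrix `amc`, a non-zero `amc`-coordinate vector `w` solving
`−(|O_i|²/R) w_i + Σ_{j ∈ nbrIdx i} amc i j w_j = λ w_i` with all moments `Σ (1+|O_i|²)^s |w_i|²` finite (= the
COORDINATES clause of the class-I `isLinNSEigenvalue_near_of_nested_certificate_of_complex_bases`) gives
`Torus.IsLinNSEigenvalue (1/(2πR)) (abcFlow 1 1 1) (2π · conj λ)`. Proof: transfer to the REAL class-I basis `bfam`
(`ccoord_transfer`; `amat` is a real matrix), conjugate the coordinate equation there, synthesise the conjugate
eigenfamily (`AbcClassISynthesis`: rapid decay, transversality, the certifiers' eigen-equation) and apply instab4's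
`AbcLatticeEigenSynthesis.isLinNSEigenvalue_abcFlow_of_certifier_eigen`. With it every class-I Hopf row reads
«`λ⋆` AND `conj λ⋆` are eigenvalues» — the PAIR. Mathlib + the files named; no new definitions. bears_on LADDER-NS N5 /
Z4-a(1) (T2/T4). [folklore].
-/

noncomputable section

open scoped BigOperators ComplexConjugate InnerProductSpace
open Finset

namespace Summit.NavierStokesRegularity.FluidComputer.AbcClassIEigenpair

open Literature.Analysis.FunctionSpaces Literature.Analysis.FunctionSpaces.Torus
open Literature.Analysis.FunctionSpaces.EuclideanSpace
open Literature.Analysis.FluidPDE Literature.Analysis.FluidPDE.SteadyLattice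
open Summit.NavierStokesRegularity.FluidComputer.AbcClassI
open Summit.NavierStokesRegularity.FluidComputer.AbcClassII (Fam crossForm secOp rotR rotS sgnOrbit cube extend
  restrictTo Orbit toOrbit onormSq osupNorm cubeOrbits nbrOrbits mem_nbrOrbits mem_nbrOrbits_comm toOrbit_eq_iff
  mem_cubeOrbits onormSq_nonneg neg_mem_of_orbitClosed inner_eq_sum_extend extend_apply_of_mem
  extend_apply_of_not_mem sq_osupNorm_le_onormSq kdot_cut sum_cube_filter_eq mem_sgnOrbit_self)

section Conjugate

variable (wf : Idx → Fam)
variable (hws : ∀ i : Idx, ∀ k ∉ i.1.1, wf i k = 0)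
variable (hwt : ∀ (i : Idx) (k : Fin 3 → ℤ), ∑ j : Fin 3, ((k j : ℤ) : ℂ) * wf i k j = 0)
variable (hwI : ∀ i : Idx, IsClassI (wf i))
variable (hwon : ∀ (O : Orbit) (a b : Fin (odim O)),
  ∑ k ∈ O.1, (inner ℂ (wf ⟨O, a⟩ k) (wf ⟨O, b⟩ k) : ℂ) = if a = b then 1 else 0)
variable (amc : Idx → Idx → ℂ)
variable (hamc : ∀ i j : Idx, amc i j =
  ∑ k ∈ i.1.1, (inner ℂ (wf i k) (Torus.lerayCoeff k (crossForm 1 1 1 (wf j) k)) : ℂ))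

include hws hwt hwI hwon hamc in
/-- **The conjugate partner.** A non-zero `amc`-coordinate eigenvector for `λ` with all moments finite (the
COORDINATES clause of the class-I end-to-end theorem) ⇒ `2π·conj λ` is an eigenvalue of the tree's linearised
operator about `abcFlow 1 1 1` at viscosity `1/(2πR)` (`L` is real: conjugate in the real class-I basis `bfam`). -/
theorem isLinNSEigenvalue_conj_of_amc_coords {R : ℝ} (hR : 1 ≤ R) (lam : ℂ)
    (wc : AbcClassI.Idx → ℂ) (hwc0 : wc ≠ 0)
    (hcoord : ∀ i : AbcClassI.Idx, ((-(onormSq i.1 / R) : ℝ) : ℂ) * wc i +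
      ∑ j ∈ AbcClassI.nbrIdx i, amc i j * wc j = lam * wc i)
    (hwsum : ∀ s : ℕ, Summable fun i : AbcClassI.Idx => (1 + onormSq i.1) ^ s * ‖wc i‖ ^ 2) :
    Torus.IsLinNSEigenvalue (1 / (2 * Real.pi * R)) (Torus.abcFlow 1 1 1) (2 * Real.pi * conj lam) := by
  classical
  have hR0 : 0 < R := by linarith
  -- transfer to the real class-I basis `bfam`
  obtain ⟨wa, -, hcoordA, hsumsA, hneA⟩ := ccoord_transfer wf hws hwt hwI hwon amc hamc lam wc hcoord
  -- the conjugate coordinates solve the `amat`-equation for `conj λ` (`amat` is real)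
  have hcoordB : ∀ i : Idx, ((-(onormSq i.1 / R) : ℝ) : ℂ) * conj (wa i) +
      ∑ j ∈ nbrIdx i, ((amat i j : ℝ) : ℂ) * conj (wa j) = conj lam * conj (wa i) := by
    intro i
    have h := congrArg conj (hcoordA i)
    rw [map_add, map_mul, map_sum, map_mul, Complex.conj_ofReal] at h
    rw [← h]
    congr 1
    exact Finset.sum_congr rfl fun j _ => by rw [map_mul, Complex.conj_ofReal]
  -- all moments of the conjugate coordinates are finite
  have hwsumB : ∀ s : ℕ, Summable fun i : Idx => (1 + onormSq i.1) ^ s * ‖conj (wa i)‖ ^ 2 := by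
    intro s
    have h := summable_of_cube_sums (fun i => (1 + onormSq i.1) ^ s)
      (fun i => pow_nonneg (by linarith [onormSq_nonneg i.1]) _) wc wa
      (fun n => hsumsA n (fun O => (1 + onormSq O) ^ s)) (hwsum s)
    refine h.congr fun i => ?_
    rw [Complex.norm_conj]
  -- synthesis of the conjugate eigenfamily in the class-I basis
  let cf : Fam := fun k => if hk : k = 0 then 0 else
    ∑ a : Fin (odim (toOrbit k hk)), conj (wa ⟨toOrbit k hk, a⟩) • bfam ⟨toOrbit k hk, a⟩ k
  have hcf0 : cf 0 = 0 := by simp [cf]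
  have hcf : ∀ O : Orbit, ∀ k ∈ O.1, cf k = ∑ a : Fin (odim O), conj (wa ⟨O, a⟩) • bfam ⟨O, a⟩ k := by
    intro O k hk
    have hk0 : k ≠ 0 := O.ne_zero_of_mem hk
    have hO : toOrbit k hk0 = O := (toOrbit_eq_iff hk0 O).mpr hk
    subst hO
    simp only [cf, dif_neg hk0]
  have hdecay : RapidDecay cf := rapidDecay_of_coordinates cf (fun i => conj (wa i)) hcf hcf0 hwsumB
  have hct := kdot_of_coordinates cf (fun i => conj (wa i)) hcf hcf0
  have hne : cf ≠ 0 := by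
    obtain ⟨i, hi⟩ : ∃ i, wa i ≠ 0 := by
      by_contra hall
      push Not at hall
      exact hneA hwc0 (funext hall)
    have hi' : conj (wa i) ≠ 0 := fun h => hi (by simpa using congrArg conj h)
    exact ne_zero_of_coordinates cf (fun i => conj (wa i)) hcf hi'
  have heq := certifier_eigen_of_coordinates (R := R) (conj lam) cf (fun i => conj (wa i)) hcf hcf0 hcoordB
  exact AbcLatticeEigenSynthesis.isLinNSEigenvalue_abcFlow_of_certifier_eigen 1 1 1 hR0 (conj lam) hdecay hct hcf0
    hne (fun k => heq k)

end Conjugate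

end Summit.NavierStokesRegularity.FluidComputer.AbcClassIEigenpair

end
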